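import Summits.NavierStokesRegularity.NavierStokesRegularity.Theses.PumpContinuation
import Literature.Analysis.FluidPDE.TaoAveragedSobolevProofs
import Summits.NavierStokesRegularity.NavierStokesRegularity.Theses.DssFarFieldSlaving
import Summits.NavierStokesRegularity.NavierStokesRegularity.Theorems.LiouvilleConjectureNS
import Literature.Analysis.FluidPDE.SelfSimilar

/-!
# Sketch (crux-ideate, ideator 2, round 1) for crux `EulerProximatePump` (stmt-NavierStokesRegularity-18302)

First lemmas of the two idea cards `zoom-sandwich` and `floquet-snake`, typed over existing
declarations. Nothing here is a proof of the crux; the two analytic stubs are `def … : Prop`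
hypotheses, and the theorems are the (elementary) logic joining them to the crux and to the
in-tree Liouville conjecture.
-/

noncomputable section

set_option linter.dupNamespace false

open MeasureTheory Set Filter
open scoped ENNReal
open Literature.Analysis.FluidPDE Literature.Analysis.FluidPDE.Tao2016
open Summit.NavierStokesRegularity.NavierStokesRegularity.Theses.PumpContinuation

namespace Summit.NavierStokesRegularity.NavierStokesRegularity.Cruxes.EulerProximatePump.Ideas

local notation "ℝ³" => EuclideanSpace ℝ (Fin 3)

/-! ## Local copies of the Disproof work-file vocabulary (`Cruxes/EulerProximatePump/Disproof.lean`,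
refuter-rattack, 2026-08-17; not importable on the farm snapshot — same bodies, same names) -/

/-- The segment form `T_θ = (1-θ) B̃_𝒜 + θ B` (copy of `Disproof.segForm`). -/
def segForm (𝒜 : AveragingDatum) (θ : ℝ) : L2C → L2C → L2C → ℂ :=
  fun a b c => ((1 - θ : ℝ) : ℂ) * 𝒜.form a b c + ((θ : ℝ) : ℂ) * eulerForm a b c

/-- Bounded-temperature blow-up for a trilinear form (copy of `Disproof.TypeIBlowupFor`). -/
def TypeIBlowupFor (T : L2C → L2C → L2C → ℂ) (M : ℝ) : Prop :=
  ∃ u₀ : SchwartzMap ℝ³ ℝ³, VectorCalculus.IsDivFree ⇑u₀ ∧ ∃ S : ℝ, 0 < S ∧ ∃ u : ℝ → L2C,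
    IsMildSolutionFor T (schwartzL2 u₀) (Ico 0 S) u ∧
    (∀ t ∈ Ico 0 S, eLpNorm (u t) ⊤ volume ≤ ENNReal.ofReal (M / Real.sqrt (S - t))) ∧
    ¬ ∃ S' : ℝ, S < S' ∧ ∃ v : ℝ → L2C,
      IsMildSolutionFor T (schwartzL2 u₀) (Ico 0 S') v ∧ ∀ t ∈ Ico 0 S, v t = u t

/-- NS Type-I mild blow-up from Schwartz data (copy of `Disproof.NSTypeIMildBlowup`). -/
def NSTypeIMildBlowup : Prop :=
  ∃ M : ℝ, TypeIBlowupFor eulerForm M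

/-- The Door refolded (copy of `Disproof.door_iff`). -/
theorem door_iff :
    EulerProximatePump ↔
      ∃ 𝒜 : AveragingDatum, 𝒜.IsSymmetric ∧ 𝒜.HasCancellation ∧ ∃ M : ℝ, ∀ δ : ℝ, 0 < δ →
        ∃ θ : ℝ, 1 - δ < θ ∧ θ < 1 ∧ 0 ≤ θ ∧ TypeIBlowupFor (segForm 𝒜 θ) M :=
  Iff.rfl

/-- The segment collapses at the Euler datum (copy of `Disproof.segForm_euler`). -/
theorem segForm_euler (θ : ℝ) : segForm AveragingDatum.euler θ = eulerForm := by
  funext a b c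
  simp only [segForm, AveragingDatum.euler_form]
  push_cast
  ring

/-- Door ⇐ NSTypeI (copy of `Disproof.door_of_nsTypeI`). -/
theorem door_of_nsTypeI (h : NSTypeIMildBlowup) : EulerProximatePump := by
  obtain ⟨M, hM⟩ := h
  rw [door_iff]
  refine ⟨AveragingDatum.euler, AveragingDatum.euler_isSymmetric,
    AveragingDatum.euler_hasCancellation, M, fun δ hδ => ?_⟩
  refine ⟨max (1 - δ / 2) 0, lt_of_lt_of_le (by linarith) (le_max_left _ _),
    max_lt (by linarith) one_pos, le_max_right _ _, ?_⟩
  rw [segForm_euler]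
  exact hM

/-! ## Card `zoom-sandwich` -/

/-- The (L^∞) temperature of an `L²`-valued curve at time `t` before the putative blow-up time
`S`: `‖u(t)‖_∞ · √(S − t)` (the Type-I ceiling of the crux says `temperature ≤ M`). -/
def temperature (u : ℝ → L2C) (S t : ℝ) : ℝ :=
  (eLpNorm (u t) ⊤ volume).toReal * Real.sqrt (S - t)

/-- **First lemma (hot core with a Calderón–Zygmund `log²` loss).** For a symmetric cancelling
datum `𝒜` there are `c > 0`, `C ≥ 0` such that every NON-EXTENDABLE `H¹⁰_df`-mild solution of the
segment form `T_θ = (1-θ)B̃_𝒜 + θB`, `θ ∈ [1/2, 1]`, from a Schwartz datum is HOT at every time,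
up to the logarithmic loss of the order-`0` multipliers on `L^∞` (far-field pile-up, controlled by
the scale-invariant energy `‖u₀‖₂² / √(S-t)`):
`c ≤ temp(t) · (1 + (1-θ)·(C + log(2 + ‖u₀‖₂²/√(S-t)) + log(2 + 1/temp(t)))²)`.
At `θ = 1` this is Leray's lower bound `‖u(t)‖_∞ ≥ c (S-t)^{-1/2}` (tree:
`leray_blowup_rate_top_holds`); the proof is the `L^∞ ∩ √t·Lip` local theory for
`∂ₜu = Δu + T_θ(u,u)` (Giga–Inui–Matsui for `B`; the `B̃` Duhamel term loses
`‖m(D)f‖_{L^∞(B_ρ)} ≲ ‖f‖_∞ (1 + log (extent/ρ))`, Stein 1993 §IV) plus persistence of `H¹⁰`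
regularity under `L^∞` control (log-Gronwall). -/
def SegmentHotCore : Prop :=
  ∀ 𝒜 : AveragingDatum, 𝒜.IsSymmetric → 𝒜.HasCancellation → ∃ c : ℝ, 0 < c ∧ ∃ C : ℝ, 0 ≤ C ∧
    ∀ θ ∈ Icc (1 / 2 : ℝ) 1, ∀ u₀ : SchwartzMap ℝ³ ℝ³, ∀ S : ℝ, 0 < S → ∀ u : ℝ → L2C,
      IsMildSolutionFor (segForm 𝒜 θ) (schwartzL2 u₀) (Ico 0 S) u →
      (¬ ∃ S' : ℝ, S < S' ∧ ∃ v : ℝ → L2C,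
          IsMildSolutionFor (segForm 𝒜 θ) (schwartzL2 u₀) (Ico 0 S') v ∧ ∀ t ∈ Ico 0 S, v t = u t) →
      ∀ t ∈ Ico 0 S,
        c ≤ temperature u S t *
          (1 + (1 - θ) * (C + Real.log (2 + ‖schwartzL2 u₀‖ ^ 2 / Real.sqrt (S - t))
            + Real.log (2 + 1 / temperature u S t)) ^ 2)

/-- **Second stub (zoom across the homotopy).** Packaged Seregin–Šverák/KNSS rescaling applied
UNIFORMLY IN `θ → 1` to a family of bounded-temperature Door witnesses, centred at provably hot
late points (`SegmentHotCore` with `S - t = exp(-(1-θ)^{-1/2})`, rescaled past `→ ∞`): local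
parabolic compactness (the booster `(1-θ)B̃` vanishes locally because the scale-invariant energy
of the witnesses enters only through `(1-θ)·log`), limit = bounded ancient mild solution of the TRUE
Navier–Stokes equations with the Type-I time decay inherited from the common ceiling `M`, hot at the
centre, and NOT slice-wise constant (a slice-wise constant hot limit with backward decay is excluded
by monotonicity of the mean energy density). Output typed against the in-tree KNSS vocabulary. -/
def SegmentZoomLimit : Prop :=
  ∀ 𝒜 : AveragingDatum, 𝒜.IsSymmetric → 𝒜.HasCancellation → ∀ M : ℝ,
    (∀ δ : ℝ, 0 < δ → ∃ θ : ℝ, 1 - δ < θ ∧ θ < 1 ∧ 0 ≤ θ ∧ TypeIBlowupFor (segForm 𝒜 θ) M) →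
    SegmentHotCore →
    ∃ v : ℝ → ℝ³ → ℝ³, IsBoundedAncientMildSolution 1 v ∧
      (∀ t < 0, AEStronglyMeasurable (v t) volume) ∧ HasTypeITimeDecay M v ∧
      ∃ t < 0, ¬ ∃ b : ℝ³, v t =ᵐ[volume] fun _ => b

/-- **The sandwich, upper slice.** A bounded-temperature Door forces a non-constant bounded
ancient mild Navier–Stokes solution with Type-I time decay (the object of KNSS's programme),
given the two analytic stubs. -/
theorem door_forces_typeI_ancient (hDoor : EulerProximatePump) (hHot : SegmentHotCore)
    (hZoom : SegmentZoomLimit) :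
    ∃ M : ℝ, ∃ v : ℝ → ℝ³ → ℝ³, IsBoundedAncientMildSolution 1 v ∧
      (∀ t < 0, AEStronglyMeasurable (v t) volume) ∧ HasTypeITimeDecay M v ∧
      ∃ t < 0, ¬ ∃ b : ℝ³, v t =ᵐ[volume] fun _ => b := by
  obtain ⟨𝒜, hs, hc, M, hM⟩ := door_iff.1 hDoor
  exact ⟨M, hZoom 𝒜 hs hc M hM hHot⟩

/-- **Corollary: the KNSS Liouville conjecture (L) refutes the Door**, given the two stubs —
the Door is at least as hard as `¬(L)` (and, by `Disproof.door_of_nsTypeI`, at most as hard as a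
Type-I Millennium counterexample). -/
theorem not_door_of_liouville
    (hL : Summit.NavierStokesRegularity.NavierStokesRegularity.LiouvilleConjectureNS)
    (hHot : SegmentHotCore) (hZoom : SegmentZoomLimit) : ¬ EulerProximatePump := by
  intro hDoor
  obtain ⟨M, v, hv, hmeas, -, t, ht, hne⟩ := door_forces_typeI_ancient hDoor hHot hZoom
  exact hne (hL v hv hmeas t ht)

/-- **Transfer target, last link (classical ⇒ Tao-mild at the Euler end).** A maximal smooth
Leray–Hopf solution from a rapidly decaying datum blowing up at the Type-I rate (the conclusion
shape of `DssFarFieldSlaving.DssTruncationBridgeTypeI`, any `ν > 0`) yields a Schwartz-data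
`H¹⁰_df`-mild Type-I blow-up of Tao's form `B` with no mild extension (`ν = 1` by scaling; the
bookkeeping inverse to the proved `PumpContinuation.MildBlowupClassical`, as inside the proved
`PerpetualPump.EulerTypeIGlue`). -/
def ClassicalTypeIToMild : Prop :=
  (∃ ν : ℝ, 0 < ν ∧ ∃ T : ℝ, 0 < T ∧ ∃ (u : ℝ → ℝ³ → ℝ³) (p : ℝ → ℝ³ → ℝ),
      IsMaximalSmoothSolution ν 0 u p T ∧ IsLerayHopfOn T ν 0 (u 0) u ∧
      HasRapidSpatialDecay (u 0) ∧ IsTypeIBlowup u T) →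
    NSTypeIMildBlowup

/-- **The sandwich, lower slice = the transfer line.** The Door follows from the DSS-profile
chain of route `DssFarFieldSlaving` (its cruxes `BlowupTypeIDssProfile`, stmt-0155, and
`DssTruncationBridgeTypeI`, stmt-14478) through `ClassicalTypeIToMild` and the Disproof's
`door_of_nsTypeI` (𝒜 := euler). -/
theorem door_of_dssChain
    (hProfile : Theses.DssFarFieldSlaving.BlowupTypeIDssProfile)
    (hBridge : Theses.DssFarFieldSlaving.DssTruncationBridgeTypeI)
    (hGlue : ClassicalTypeIToMild) : EulerProximatePump :=
  door_of_nsTypeI (hGlue (hBridge hProfile))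

/-! ## Card `floquet-snake` -/

/-- **First lemma (Leray–Schauder global continuation of fixed points of a compact family).**
For a completely continuous family `Φ : ℝ × E → E` and a fixed point `x₀` of `Φ(0,·)` which is
nondegenerate (`1 ∉ σ(DΦ(0,·)(x₀))`, hence isolated of Leray–Schauder index `±1`), the connected
component through `(0, x₀)` of the fixed-point set over `θ ∈ [0,1]` reaches `θ = 1`, or is
unbounded, or returns to `θ = 0` at another fixed point (Leray–Schauder 1934; Rabinowitz 1971;
Mawhin 1999, "Leray–Schauder continuation theorems"; the period-map version for periodic orbits is
Mallet-Paret–Yorke 1982 / Fiedler 1988, LNM 1309, §3). To be vendored as a Literature fact; here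
the shape only. Applied to `Φ_θ :=` the `k`-th iterate of the period map of the rescaled,
`2 log λ`-periodically parametrised `T_θ`-flow composed with the scaling-phase normalisation,
`x₀ :=` the seed's DSS orbit of `AveragedTypeIBlowup_of`. -/
def LeraySchauderContinuation (E : Type) [NormedAddCommGroup E] [NormedSpace ℝ E]
    [CompleteSpace E] : Prop :=
  ∀ (Φ : ℝ × E → E), Continuous Φ →
    (∀ B : Set (ℝ × E), Bornology.IsBounded B → IsCompact (closure (Φ '' B))) →
    ∀ (x₀ : E) (L : E →L[ℝ] E), Φ (0, x₀) = x₀ → HasFDerivAt (fun x => Φ (0, x)) L x₀ →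
      (1 : ℝ) ∉ spectrum ℝ L →
      let K : Set (ℝ × E) := {q | q.1 ∈ Icc (0 : ℝ) 1 ∧ Φ q = q.2}
      (∃ x : E, ((1 : ℝ), x) ∈ connectedComponentIn K ((0 : ℝ), x₀)) ∨
        ¬ Bornology.IsBounded (connectedComponentIn K ((0 : ℝ), x₀)) ∨
        (∃ x : E, x ≠ x₀ ∧ ((0 : ℝ), x) ∈ connectedComponentIn K ((0 : ℝ), x₀))

/-- **What the snake delivers without any a-priori bound: the HOT door.** Along an unbounded or
arriving continuum the blow-up persists with SOME ceiling for parameters accumulating at `1`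
(overheating allowed). The crux is the hot door plus `NoOverheating` below. -/
def HotDoor (𝒜 : AveragingDatum) : Prop :=
  ∀ δ : ℝ, 0 < δ → ∃ θ : ℝ, 1 - δ < θ ∧ θ < 1 ∧ 0 ≤ θ ∧ ∃ M : ℝ, TypeIBlowupFor (segForm 𝒜 θ) M

/-- **The single NS-hard stub isolated by the snake: no overheating along a sequence.** -/
def NoOverheating (𝒜 : AveragingDatum) : Prop :=
  ∃ M : ℝ, ∀ δ : ℝ, 0 < δ → ∃ θ : ℝ, 1 - δ < θ ∧ θ < 1 ∧ 0 ≤ θ ∧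
    ((∃ M' : ℝ, TypeIBlowupFor (segForm 𝒜 θ) M') → TypeIBlowupFor (segForm 𝒜 θ) M)

/-- Hot door at the parameters selected by `NoOverheating` gives the Door (pure logic; the two
`∃ θ` must be synchronised, which is why `NoOverheating` is phrased along its own sequence and the
hot door is required on a TAIL: here in the convenient form "blow-up with some ceiling at every
`θ` of the no-overheating sequence"). -/
theorem door_of_hot_noOverheating {𝒜 : AveragingDatum} (hs : 𝒜.IsSymmetric)
    (hc : 𝒜.HasCancellation)
    (h : ∃ M : ℝ, ∀ δ : ℝ, 0 < δ → ∃ θ : ℝ, 1 - δ < θ ∧ θ < 1 ∧ 0 ≤ θ ∧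
      (∃ M' : ℝ, TypeIBlowupFor (segForm 𝒜 θ) M') ∧
      ((∃ M' : ℝ, TypeIBlowupFor (segForm 𝒜 θ) M') → TypeIBlowupFor (segForm 𝒜 θ) M)) :
    EulerProximatePump := by
  obtain ⟨M, hM⟩ := h
  rw [door_iff]
  refine ⟨𝒜, hs, hc, M, fun δ hδ => ?_⟩
  obtain ⟨θ, h1, h2, h3, hhot, himp⟩ := hM δ hδ
  exact ⟨θ, h1, h2, h3, himp hhot⟩

end Summit.NavierStokesRegularity.NavierStokesRegularity.Cruxes.EulerProximatePump.Ideas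

end
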